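import Literature.NumberTheory.Automorphic.UnitaryGroupFrameEmbeddingLevels
import Literature.NumberTheory.Automorphic.UnitaryGroupDirectSumCarriersFinite
import Literature.NumberTheory.Automorphic.UnitaryGroupCongruenceLevels
import HarnessLib

/-!
# The stabiliser of `W^⊥ = B·(E^{N₁} ⊕ 0)` in `U(H)(F)` is `B·(U(J₁) × U(J₂))·B⁻¹`, and its `U(J₂)`-part dies at deep level

[Deligne1971TravauxShimura] Prop. 1.15 (proof, pp. 132–133: injectivity of `_K M(H) → _K M(G)` for a sub-datum `H ↪ G` at small
level) read for the unitary sub-datum `U(W^⊥) ↪ U(V)` of an orthogonal decomposition `V = W^⊥ ⊕ W` ([Kudla1984] §1 see-saw;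
[Liu2021] Thm. 4.15 proof l. 2193–2213, `G⋆ ↪ G`), in the tree's frame currency (★ `UnitaryGroupFrameEmbedding`,
★ `UnitaryGroupFrameEmbeddingLevels`): a frame `B ∈ GL_{N₁+N₂}(E)` with `ᵗ(cB)·(a•H)·B = J₁ ⊕ᶠ J₂` identifies `W^⊥ = B·(E^{N₁} ⊕ 0)`,
`W = B·(0 ⊕ E^{N₂})`, `U(J₁) = U(W^⊥)`, `U(J₂) = U(W)`.  PROOF FILE, theorems only (no definition, no named fact, no instance,
no `sorry`); elementary block-matrix algebra and level bookkeeping.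

* §1 `fromBlocks_zero₂₁_mem_unitary_iff` — a `σ`-unitary matrix for `J₁ ⊕ J₂` (`J₁` non-degenerate) whose lower-left block vanishes
  is block diagonal with `σ`-unitary diagonal blocks (`Sum`-indexed `Matrix.fromBlocks` form).
* §2 `exists_eq_blockDiagFin_of_apply_natAdd_castAdd_eq_zero` — the same in the concatenated `Fin (N₁ + N₂)` basis: an element of
  `U(σ, J₁ ⊕ᶠ J₂)` mapping `E^{N₁} ⊕ 0` into itself is `blockDiagFin (γ₁, γ₂)`.
* §3 `exists_eq_conj_rationalBlockDiag_of_mulVec_frameEmb` — through the frame: `γ ∈ U(H)(F)` with `γ·B(x ⊕ 0) ∈ B(E^{N₁} ⊕ 0)` for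
  all `x` is `B·(γ₁ ⊕ᶠ γ₂)·B⁻¹`, `γ₁ ∈ U(J₁)(F)`, `γ₂ ∈ U(J₂)(F)` («`Stab(W^⊥) = Stab(W) = U(W^⊥) × U(W)`»).
* §5 `finAdelicBlockDiag_mem_finCongruenceLevel_iff`, `finAdelicCongr_finAdelicBlockDiag_mem_map_iff` — block-diagonal elements of the
  principal congruence level `K_{U(J₁ ⊕ᶠ J₂),f}(𝔫)` split blockwise; hence so do elements of the `B`-ADAPTED level
  `B_f·K_{U(J₁ ⊕ᶠ J₂),f}(𝔫)·B_f⁻¹ ≤ U(H)(𝔸_{F,f})` (the principal level of the lattice `B·(𝓞_E^{N₁} ⊕ 𝓞_E^{N₂})`, ★ `finAdelicCongr`).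
* SEQUEL `UnitaryGroupFrameStabiliserLevel.lean` (imports ★ `UnitaryGroupLevelDet`): the `N₂ = 1` kill `eq_one_of_mem_arithmeticLevel_fin_one`
  and the HEAD `exists_eq_embRational_of_mulVec_frameEmb_of_mem_level` = case (A) of [Del71] 1.15 for `U(W^⊥) ↪ U(V)` (a stabilising
  rational witness at `B`-adapted depth `n ≥ 3` IS `embRational γ⋆`).

Use (cell `hodgecm-mathlib`, road (ii) R2-1-inj of A-p10's census «GS-3 ⇐ #62», leaf (F-A) of A-p15's census
`CENSUS-R2-1-inj` §2 (A)/§3): the sequel's head is the hypothesis `hcaseA` of A-p15's assembly `ShimuraSetGS.embPoints_injective_of_witnesses`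
(★ `UnitaryShimuraCurveEmbeddingInjective.lean`) at `B`-adapted depth `3 ∣ 𝔫`.  Books 0; HC_CM is proved only modulo the printed
citations until rung 0 closes.

## References
* [Deligne1971TravauxShimura] P. Deligne, *Travaux de Shimura*, Sém. Bourbaki 389 (1971), Prop. 1.15 and its proof pp. 132–133
  (Variante 1.15.1, Lemmes 1.15.2–1.15.3).
* [Milne2005ShimuraVarieties] J. S. Milne, *Introduction to Shimura varieties* (2005), Thm. 5.16 and Rem. 13.8.
* [Kudla1984] §1 · [PlatonovRapinchuk1994] §2.3, §4.1, §5.1 · [Minkowski1887] §1 (via ★ `UnitaryGroupLevelDet`).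
-/

set_option autoImplicit false

noncomputable section

namespace Literature.NumberTheory.Automorphic.UnitaryGroup

open _root_.Matrix NumberField

/-! ## §1 Block algebra: a unitary block-upper-triangular matrix is block diagonal -/

section Blocks

variable {S : Type*} [Field S] (σ : S →+* S) {n₁ n₂ : Type*} [Fintype n₁] [Fintype n₂] [DecidableEq n₁]

/-- **A `σ`-unitary matrix for `J₁ ⊕ J₂` whose lower-left block vanishes is block diagonal, with `σ`-unitary diagonal
blocks** (`J₁` non-degenerate): `M = [[P, Q], [0, T]]` satisfies `ᵗ(σM)·(J₁ ⊕ J₂)·M = J₁ ⊕ J₂` iff `Q = 0`, `ᵗ(σP)·J₁·P = J₁` and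
`ᵗ(σT)·J₂·T = J₂` — the stabiliser of the first summand `S^{n₁} ⊕ 0` in `U(J₁ ⊕ J₂)` is `U(J₁) × U(J₂)` (the «`Stab = U(W^⊥) × U(W)`»
step of [Deligne1971TravauxShimura] Prop. 1.15's injectivity argument for `U(W^⊥) ↪ U(V)`).
[cite: Deligne1971TravauxShimura, Prop. 1.15 (proof, p. 132)] [cite: Kudla1984, §1] -/
theorem fromBlocks_zero₂₁_mem_unitary_iff {J₁ : Matrix n₁ n₁ S} {J₂ : Matrix n₂ n₂ S} (hJ₁ : J₁.det ≠ 0)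
    (P : Matrix n₁ n₁ S) (Q : Matrix n₁ n₂ S) (T : Matrix n₂ n₂ S) :
    ((Matrix.fromBlocks P Q 0 T).map σ)ᵀ * Matrix.fromBlocks J₁ 0 0 J₂ * Matrix.fromBlocks P Q 0 T =
        Matrix.fromBlocks J₁ 0 0 J₂ ↔
      Q = 0 ∧ (P.map σ)ᵀ * J₁ * P = J₁ ∧ (T.map σ)ᵀ * J₂ * T = J₂ := by
  rw [Matrix.fromBlocks_map, Matrix.fromBlocks_transpose, Matrix.map_zero σ (map_zero σ), Matrix.transpose_zero,
    Matrix.fromBlocks_multiply, Matrix.fromBlocks_multiply]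
  simp only [Matrix.mul_zero, Matrix.zero_mul, add_zero, zero_add]
  rw [Matrix.fromBlocks_inj]
  constructor
  · rintro ⟨h11, h12, -, h22⟩
    -- `ᵗ(σP)·J₁` is invertible: `σ(det P) · det J₁ · det P = det J₁`
    have hdet := congrArg Matrix.det h11
    rw [Matrix.det_mul, Matrix.det_mul, Matrix.det_transpose] at hdet
    have hPσ : ((P.map σ)ᵀ * J₁).det ≠ 0 := by
      intro h0
      rw [Matrix.det_mul, Matrix.det_transpose] at h0
      rw [h0, zero_mul] at hdet
      exact hJ₁ hdet.symm
    have hQ : Q = 0 := by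
      have hu : IsUnit ((P.map σ)ᵀ * J₁).det := isUnit_iff_ne_zero.2 hPσ
      calc Q = ((P.map σ)ᵀ * J₁)⁻¹ * (((P.map σ)ᵀ * J₁) * Q) := (Matrix.nonsing_inv_mul_cancel_left _ Q hu).symm
        _ = 0 := by rw [h12, Matrix.mul_zero]
    refine ⟨hQ, h11, ?_⟩
    rw [hQ, Matrix.map_zero σ (map_zero σ), Matrix.transpose_zero, Matrix.zero_mul, Matrix.zero_mul, zero_add] at h22
    exact h22
  · rintro ⟨hQ, hP, hT⟩
    subst hQ
    refine ⟨hP, ?_, ?_, ?_⟩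
    · rw [Matrix.mul_zero]
    · rw [Matrix.map_zero σ (map_zero σ), Matrix.transpose_zero, Matrix.zero_mul, Matrix.zero_mul]
    · rw [Matrix.map_zero σ (map_zero σ), Matrix.transpose_zero, Matrix.zero_mul, Matrix.zero_mul, zero_add, hT]

end Blocks

/-! ## §2 `Fin`-indexed form: the stabiliser of `S^{N₁} ⊕ 0` in `U(J₁ ⊕ᶠ J₂)` is `blockDiagFin (U(J₁) × U(J₂))` -/

section FinBlocks

variable {S : Type*} [Field S] (σ : S →+* S) {N₁ N₂ : ℕ}

/-- **An element of `U(σ, J₁ ⊕ᶠ J₂)` mapping the first summand `S^{N₁} ⊕ 0` into itself is block diagonal**: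
`g = blockDiagFin (γ₁, γ₂)` with `γ₁ ∈ U(σ, J₁)`, `γ₂ ∈ U(σ, J₂)` (`J₁` non-degenerate).  The hypothesis is the entrywise form
`g (natAdd i) (castAdd j) = 0` of «`g(x ⊕ 0) ∈ S^{N₁} ⊕ 0` for all `x`».
[cite: Deligne1971TravauxShimura, Prop. 1.15 (proof, p. 132)] [cite: Kudla1984, §1] -/
theorem exists_eq_blockDiagFin_of_apply_natAdd_castAdd_eq_zero {J₁ : Matrix (Fin N₁) (Fin N₁) S}
    {J₂ : Matrix (Fin N₂) (Fin N₂) S} (hJ₁ : J₁.det ≠ 0) {g : GL (Fin (N₁ + N₂)) S}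
    (hg : g ∈ unitaryGroupOfForm σ (finSum N₁ N₂ J₁ J₂))
    (hV : ∀ (i : Fin N₂) (j : Fin N₁), (g : Matrix (Fin (N₁ + N₂)) (Fin (N₁ + N₂)) S) (Fin.natAdd N₁ i) (Fin.castAdd N₂ j) = 0) :
    ∃ γ : unitaryGroupOfForm σ J₁ × unitaryGroupOfForm σ J₂,
      g = ((blockDiagFin σ J₁ J₂ γ : unitaryGroupOfForm σ (finSum N₁ N₂ J₁ J₂)) : GL (Fin (N₁ + N₂)) S) := by
  classical
  -- the matrix of `g` in `Sum` coordinates and its blocks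
  set M : Matrix (Fin N₁ ⊕ Fin N₂) (Fin N₁ ⊕ Fin N₂) S :=
    (g : Matrix (Fin (N₁ + N₂)) (Fin (N₁ + N₂)) S).submatrix finSumFinEquiv finSumFinEquiv with hMdef
  have hR : M.toBlocks₂₁ = 0 := by
    ext i j
    simp only [Matrix.toBlocks₂₁, hMdef, Matrix.submatrix_apply, finSumFinEquiv_apply_left, finSumFinEquiv_apply_right,
      Matrix.of_apply, Matrix.zero_apply]
    exact hV i j
  have hM : M = Matrix.fromBlocks M.toBlocks₁₁ M.toBlocks₁₂ 0 M.toBlocks₂₂ := by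
    conv_lhs => rw [← Matrix.fromBlocks_toBlocks M, hR]
  -- unitarity in `Sum` coordinates
  have hu : (M.map σ)ᵀ * Matrix.fromBlocks J₁ 0 0 J₂ * M = Matrix.fromBlocks J₁ 0 0 J₂ := by
    have h1 := congrArg (fun A : Matrix (Fin (N₁ + N₂)) (Fin (N₁ + N₂)) S => A.submatrix finSumFinEquiv finSumFinEquiv)
      (mem_unitaryGroupOfForm_iff.1 hg)
    rw [finSum_submatrix, ← Matrix.submatrix_mul_equiv _ _ _ (finSumFinEquiv (m := N₁) (n := N₂)) _,
      ← Matrix.submatrix_mul_equiv _ _ _ (finSumFinEquiv (m := N₁) (n := N₂)) _, finSum_submatrix,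
      ← Matrix.transpose_submatrix, Matrix.submatrix_map, ← hMdef] at h1
    exact h1
  rw [hM] at hu
  obtain ⟨hQ, hP, hT⟩ := (fromBlocks_zero₂₁_mem_unitary_iff σ hJ₁ _ _ _).1 hu
  -- the diagonal blocks are invertible (`det g = det P · det T`)
  have hdet : M.toBlocks₁₁.det * M.toBlocks₂₂.det ≠ 0 := by
    rw [← Matrix.det_fromBlocks_zero₂₁ M.toBlocks₁₁ M.toBlocks₁₂ M.toBlocks₂₂, ← hM, hMdef,
      Matrix.det_submatrix_equiv_self]
    exact (Matrix.GeneralLinearGroup.det g).ne_zero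
  let γ₁ : GL (Fin N₁) S := Matrix.GeneralLinearGroup.mkOfDetNeZero M.toBlocks₁₁ (left_ne_zero_of_mul hdet)
  let γ₂ : GL (Fin N₂) S := Matrix.GeneralLinearGroup.mkOfDetNeZero M.toBlocks₂₂ (right_ne_zero_of_mul hdet)
  have hγ₁ : γ₁ ∈ unitaryGroupOfForm σ J₁ := hP
  have hγ₂ : γ₂ ∈ unitaryGroupOfForm σ J₂ := hT
  refine ⟨(⟨γ₁, hγ₁⟩, ⟨γ₂, hγ₂⟩), Units.ext ?_⟩
  rw [coe_blockDiagFin]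
  change (g : Matrix (Fin (N₁ + N₂)) (Fin (N₁ + N₂)) S) = Matrix.reindex finSumFinEquiv finSumFinEquiv
    (Matrix.fromBlocks M.toBlocks₁₁ 0 0 M.toBlocks₂₂)
  rw [← hQ, ← hM, hMdef, Matrix.reindex_apply, Matrix.submatrix_submatrix, Equiv.self_comp_symm, Matrix.submatrix_id_id]

end FinBlocks

/-! ## §3 Through a frame `ᵗ(cB)·(a•H)·B = J₁ ⊕ᶠ J₂`: the stabiliser of `W^⊥ = B·(E^{N₁} ⊕ 0)` in `U(H)(F)` -/

section Framed

variable (F E : Type) [Field F] [NumberField F] [Field E] [NumberField E] [Algebra F E]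
variable (c : E ≃ₐ[F] E) (N₁ N₂ : ℕ) (J₁ : Matrix (Fin N₁) (Fin N₁) E) (J₂ : Matrix (Fin N₂) (Fin N₂) E)
variable (H : Matrix (Fin (N₁ + N₂)) (Fin (N₁ + N₂)) E) (B : GL (Fin (N₁ + N₂)) E)

omit [NumberField F] [NumberField E] in
/-- `(Pi.single j 1) ⊕ 0 = Pi.single (castAdd j) 1` in the concatenated basis (plumbing). [folklore] -/
private theorem append_single_zero (j : Fin N₁) :
    Fin.append (Pi.single j (1 : E)) (0 : Fin N₂ → E) = Pi.single (Fin.castAdd N₂ j) 1 := by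
  funext k
  induction k using Fin.addCases with
  | left j' =>
    rw [Fin.append_left]
    by_cases h : j' = j
    · subst h; rw [Pi.single_eq_same, Pi.single_eq_same]
    · rw [Pi.single_eq_of_ne h, Pi.single_eq_of_ne (fun h' => h ((Fin.castAdd_injective N₁ N₂) h'))]
  | right i =>
    have hne : Fin.natAdd N₁ i ≠ Fin.castAdd N₂ j := by
      intro h
      have h' := congrArg Fin.val h
      simp only [Fin.val_castAdd, Fin.val_natAdd] at h'
      omega
    rw [Fin.append_right, Pi.zero_apply, Pi.single_eq_of_ne hne]

omit [NumberField F] [NumberField E] in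
/-- **An element of `U(H)(F)` stabilising the `F`-rational subspace `W^⊥ = B·(E^{N₁} ⊕ 0)` of a frame `ᵗ(cB)·(a•H)·B = J₁ ⊕ᶠ J₂`
is `B·(γ₁ ⊕ᶠ γ₂)·B⁻¹` with `γ₁ ∈ U(J₁)(F)`, `γ₂ ∈ U(J₂)(F)`** (`J₁` non-degenerate): `Stab_{U(H)(F)}(W^⊥) = B·(U(J₁)(F) × U(J₂)(F))·B⁻¹`
(★ `rationalBlockDiag`; its `γ₂ = 1` part is ★ `embRational γ₁`) — the case «`qV⋆ = V⋆`» of [Deligne1971TravauxShimura] Prop. 1.15's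
injectivity proof for `U(V⋆) ↪ U(V)`. [cite: Deligne1971TravauxShimura, Prop. 1.15 (proof, p. 132)] [cite: Kudla1984, §1]
[cite: PlatonovRapinchuk1994, §2.3] -/
theorem exists_eq_conj_rationalBlockDiag_of_mulVec_frameEmb {a : E} (ha : a ≠ 0)
    (hB : formCongr (c : E →+* E) B (a • H) = finSum N₁ N₂ J₁ J₂) (hJ₁ : J₁.det ≠ 0) {g : GL (Fin (N₁ + N₂)) E}
    (hg : g ∈ rational F E c (N₁ + N₂) H)
    (hV : ∀ x : Fin N₁ → E, ∃ x' : Fin N₁ → E,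
      (g : Matrix (Fin (N₁ + N₂)) (Fin (N₁ + N₂)) E) *ᵥ ((B : Matrix (Fin (N₁ + N₂)) (Fin (N₁ + N₂)) E) *ᵥ Fin.append x 0) =
        (B : Matrix (Fin (N₁ + N₂)) (Fin (N₁ + N₂)) E) *ᵥ Fin.append x' 0) :
    ∃ γ : rational F E c N₁ J₁ × rational F E c N₂ J₂,
      g = B * ((rationalBlockDiag F E c N₁ N₂ J₁ J₂ γ : rational F E c (N₁ + N₂) (finSum N₁ N₂ J₁ J₂)) :
        GL (Fin (N₁ + N₂)) E) * B⁻¹ := by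
  -- `g' := B⁻¹ g B ∈ U(J₁ ⊕ᶠ J₂)(F)`
  have hg' : B⁻¹ * g * B ∈ rational F E c (N₁ + N₂) (finSum N₁ N₂ J₁ J₂) := by
    rw [conj_mem_rational_iff F E c B ha hB]
    simpa only [mul_assoc, mul_inv_cancel, mul_one, mul_inv_cancel_left] using hg
  -- `g'` maps `E^{N₁} ⊕ 0` into itself: its lower-left block vanishes
  have hV' : ∀ (i : Fin N₂) (j : Fin N₁),
      (((B⁻¹ * g * B : GL (Fin (N₁ + N₂)) E)) : Matrix (Fin (N₁ + N₂)) (Fin (N₁ + N₂)) E) (Fin.natAdd N₁ i) (Fin.castAdd N₂ j) = 0 := by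
    intro i j
    obtain ⟨x', hx'⟩ := hV (Pi.single j 1)
    have h1 : (((B⁻¹ * g * B : GL (Fin (N₁ + N₂)) E)) : Matrix (Fin (N₁ + N₂)) (Fin (N₁ + N₂)) E) *ᵥ
        Fin.append (Pi.single j (1 : E)) (0 : Fin N₂ → E) = Fin.append x' (0 : Fin N₂ → E) := by
      rw [Units.val_mul, Units.val_mul, ← Matrix.mulVec_mulVec, ← Matrix.mulVec_mulVec, hx', Matrix.mulVec_mulVec,
        ← Units.val_mul, inv_mul_cancel, Units.val_one, Matrix.one_mulVec]
    have h2 := congrFun h1 (Fin.natAdd N₁ i)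
    rw [Fin.append_right, Pi.zero_apply, append_single_zero, Matrix.mulVec_single_one] at h2
    exact h2
  obtain ⟨γ, hγ⟩ := exists_eq_blockDiagFin_of_apply_natAdd_castAdd_eq_zero (c : E →+* E) hJ₁ hg' hV'
  refine ⟨γ, ?_⟩
  rw [coe_rationalBlockDiag, ← coe_blockDiagFin_eq, ← hγ]
  simp only [mul_assoc, mul_inv_cancel, mul_one, mul_inv_cancel_left]

end Framed

/-! ## §5 Levels: block-diagonal elements of the principal congruence levels, and the `B`-adapted levels -/

section ValuedBlocks

variable {K Γ₀ : Type*} [Field K] [LinearOrderedCommGroupWithZero Γ₀] [Valued K Γ₀] {N₁ N₂ : ℕ}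

/-- A property of all entries of `reindex (fromBlocks A B C D)` (concatenated `Fin` basis) is the conjunction of the property on
the four blocks (plumbing). [folklore] -/
private theorem forall_reindex_fromBlocks_iff {α : Type*} (P : α → Prop) (A : Matrix (Fin N₁) (Fin N₁) α)
    (B : Matrix (Fin N₁) (Fin N₂) α) (C : Matrix (Fin N₂) (Fin N₁) α) (D : Matrix (Fin N₂) (Fin N₂) α) :
    (∀ i j, P (Matrix.reindex finSumFinEquiv finSumFinEquiv (Matrix.fromBlocks A B C D) i j)) ↔
      (∀ i j, P (A i j)) ∧ (∀ i j, P (B i j)) ∧ (∀ i j, P (C i j)) ∧ (∀ i j, P (D i j)) := by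
  constructor
  · intro h
    refine ⟨fun i j => ?_, fun i j => ?_, fun i j => ?_, fun i j => ?_⟩
    · simpa only [Matrix.reindex_apply, Matrix.submatrix_apply, finSumFinEquiv_symm_apply_castAdd,
        Matrix.fromBlocks_apply₁₁] using h (Fin.castAdd N₂ i) (Fin.castAdd N₂ j)
    · simpa only [Matrix.reindex_apply, Matrix.submatrix_apply, finSumFinEquiv_symm_apply_castAdd,
        finSumFinEquiv_symm_apply_natAdd, Matrix.fromBlocks_apply₁₂] using h (Fin.castAdd N₂ i) (Fin.natAdd N₁ j)
    · simpa only [Matrix.reindex_apply, Matrix.submatrix_apply, finSumFinEquiv_symm_apply_castAdd,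
        finSumFinEquiv_symm_apply_natAdd, Matrix.fromBlocks_apply₂₁] using h (Fin.natAdd N₁ i) (Fin.castAdd N₂ j)
    · simpa only [Matrix.reindex_apply, Matrix.submatrix_apply, finSumFinEquiv_symm_apply_natAdd,
        Matrix.fromBlocks_apply₂₂] using h (Fin.natAdd N₁ i) (Fin.natAdd N₁ j)
  · rintro ⟨hA, hB, hC, hD⟩ i j
    induction i using Fin.addCases with
    | left i =>
      induction j using Fin.addCases with
      | left j => simpa only [Matrix.reindex_apply, Matrix.submatrix_apply, finSumFinEquiv_symm_apply_castAdd,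
          Matrix.fromBlocks_apply₁₁] using hA i j
      | right j => simpa only [Matrix.reindex_apply, Matrix.submatrix_apply, finSumFinEquiv_symm_apply_castAdd,
          finSumFinEquiv_symm_apply_natAdd, Matrix.fromBlocks_apply₁₂] using hB i j
    | right i =>
      induction j using Fin.addCases with
      | left j => simpa only [Matrix.reindex_apply, Matrix.submatrix_apply, finSumFinEquiv_symm_apply_castAdd,
          finSumFinEquiv_symm_apply_natAdd, Matrix.fromBlocks_apply₂₁] using hC i j
      | right j => simpa only [Matrix.reindex_apply, Matrix.submatrix_apply, finSumFinEquiv_symm_apply_natAdd,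
          Matrix.fromBlocks_apply₂₂] using hD i j

/-- **A block-diagonal matrix lies in the valued congruence subgroup of radius `r` iff both blocks do**: the entries of
`diag(x₁, x₂)`, `diag(x₁, x₂)⁻¹ = diag(x₁⁻¹, x₂⁻¹)` and `diag(x₁, x₂) − 1 = diag(x₁ − 1, x₂ − 1)` are those of the blocks and zeros.
[cite: PlatonovRapinchuk1994, §5.1] -/
theorem reindexGL_blockDiagGL_mem_valuedCongruenceSubgroup_iff (r : Γ₀) (x₁ : GL (Fin N₁) K) (x₂ : GL (Fin N₂) K) :
    reindexGL finSumFinEquiv (blockDiagGL (x₁, x₂)) ∈ valuedCongruenceSubgroup (Fin (N₁ + N₂)) r ↔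
      x₁ ∈ valuedCongruenceSubgroup (Fin N₁) r ∧ x₂ ∈ valuedCongruenceSubgroup (Fin N₂) r := by
  have hinv : (reindexGL finSumFinEquiv (blockDiagGL (x₁, x₂)))⁻¹ = reindexGL (S := K) finSumFinEquiv (blockDiagGL (x₁⁻¹, x₂⁻¹)) := by
    rw [← map_inv, ← map_inv, Prod.inv_mk]
  have hblk : Matrix.fromBlocks ((x₁ : Matrix (Fin N₁) (Fin N₁) K) - 1) 0 0 ((x₂ : Matrix (Fin N₂) (Fin N₂) K) - 1) =
      Matrix.fromBlocks (x₁ : Matrix (Fin N₁) (Fin N₁) K) 0 0 (x₂ : Matrix (Fin N₂) (Fin N₂) K) - 1 := by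
    ext (i | i) (j | j) <;> simp [Matrix.one_apply]
  have hsub : ((reindexGL finSumFinEquiv (blockDiagGL (x₁, x₂)) : GL (Fin (N₁ + N₂)) K) : Matrix (Fin (N₁ + N₂)) (Fin (N₁ + N₂)) K) - 1 =
      Matrix.reindex finSumFinEquiv finSumFinEquiv
        (Matrix.fromBlocks ((x₁ : Matrix (Fin N₁) (Fin N₁) K) - 1) 0 0 ((x₂ : Matrix (Fin N₂) (Fin N₂) K) - 1)) := by
    rw [hblk, coe_reindexGL, coe_blockDiagGL, Matrix.reindex_apply, Matrix.reindex_apply]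
    change _ = (Matrix.fromBlocks (x₁ : Matrix (Fin N₁) (Fin N₁) K) 0 0 (x₂ : Matrix (Fin N₂) (Fin N₂) K)).submatrix _ _ -
      (1 : Matrix (Fin N₁ ⊕ Fin N₂) (Fin N₁ ⊕ Fin N₂) K).submatrix _ _
    rw [Matrix.submatrix_one_equiv]
  have h0 : ∀ (s : Γ₀), (∀ (i : Fin N₁) (j : Fin N₂), Valued.v ((0 : Matrix (Fin N₁) (Fin N₂) K) i j) ≤ s) ↔ True := fun s =>
    ⟨fun _ => trivial, fun _ i j => by simp⟩
  have h0' : ∀ (s : Γ₀), (∀ (i : Fin N₂) (j : Fin N₁), Valued.v ((0 : Matrix (Fin N₂) (Fin N₁) K) i j) ≤ s) ↔ True := fun s =>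
    ⟨fun _ => trivial, fun _ i j => by simp⟩
  rw [mem_valuedCongruenceSubgroup_iff, mem_valuedCongruenceSubgroup_iff, mem_valuedCongruenceSubgroup_iff, hinv, hsub,
    coe_reindexGL, coe_blockDiagGL, coe_reindexGL, coe_blockDiagGL,
    forall_reindex_fromBlocks_iff (fun t : K => Valued.v t ≤ 1), forall_reindex_fromBlocks_iff (fun t : K => Valued.v t ≤ 1),
    forall_reindex_fromBlocks_iff (fun t : K => Valued.v t ≤ r)]
  simp only [h0, h0', true_and]
  tauto

end ValuedBlocks

section Levels

variable (F E : Type) [Field F] [NumberField F] [Field E] [NumberField E] [Algebra F E]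
variable (c : E ≃ₐ[F] E) (N₁ N₂ : ℕ) (J₁ : Matrix (Fin N₁) (Fin N₁) E) (J₂ : Matrix (Fin N₂) (Fin N₂) E)
variable (H : Matrix (Fin (N₁ + N₂)) (Fin (N₁ + N₂)) E) (B : GL (Fin (N₁ + N₂)) E) {a : E} (ha : a ≠ 0)
variable (hB : formCongr (c : E →+* E) B (a • H) = finSum N₁ N₂ J₁ J₂)

omit [NumberField F] in
/-- **Block-diagonal elements of the principal congruence level**: `u₁ ⊕ᶠ u₂ ∈ K_{U(J₁ ⊕ᶠ J₂),f}(𝔫)` iff `u₁ ∈ K_{U(J₁),f}(𝔫)` and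
`u₂ ∈ K_{U(J₂),f}(𝔫)` (placewise, ★ `mem_finCongruenceLevel_iff_forall`; the level of the STANDARD lattice `𝓞_E^{N₁} ⊕ 𝓞_E^{N₂}`, which
is split along the blocks). [cite: PlatonovRapinchuk1994, §5.1] [cite: BorelJacquet1979, §4.1] -/
theorem finAdelicBlockDiag_mem_finCongruenceLevel_iff (𝔫 : Ideal (NumberField.RingOfIntegers E))
    (u : finAdelic F E c N₁ J₁ × finAdelic F E c N₂ J₂) :
    finAdelicBlockDiag F E c N₁ N₂ J₁ J₂ u ∈ finCongruenceLevel F E c (N₁ + N₂) (finSum N₁ N₂ J₁ J₂) 𝔫 ↔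
      u.1 ∈ finCongruenceLevel F E c N₁ J₁ 𝔫 ∧ u.2 ∈ finCongruenceLevel F E c N₂ J₂ 𝔫 := by
  rw [mem_finCongruenceLevel_iff_forall, mem_finCongruenceLevel_iff_forall, mem_finCongruenceLevel_iff_forall,
    ← forall_and]
  refine forall_congr' fun w => ?_
  rw [coe_finAdelicBlockDiag]
  change Matrix.GeneralLinearGroup.map _ (reindexGL finSumFinEquiv (blockDiagGL _)) ∈ _ ↔ _
  rw [map_reindexGL, map_blockDiagGL, reindexGL_blockDiagGL_mem_valuedCongruenceSubgroup_iff]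
  rfl

omit [NumberField F] in
/-- **The stabiliser element on the finite adeles**: `B_f·((γ₁)_f ⊕ᶠ (γ₂)_f)·B_f⁻¹ = (B·(γ₁ ⊕ᶠ γ₂)·B⁻¹)_f`, i.e.
`finAdelicCongr B ((γ₁)_f ⊕ᶠ (γ₂)_f) = (B·(γ₁ ⊕ᶠ γ₂)·B⁻¹)_f` (★ `finAdelicBlockDiag_rationalToFinAdelic` then ★
`finAdelicCongr_rationalToFinAdelic`). [cite: PlatonovRapinchuk1994, §5.1] -/
theorem finAdelicCongr_finAdelicBlockDiag_rationalToFinAdelic_pair (γ₁ : rational F E c N₁ J₁) (γ₂ : rational F E c N₂ J₂) :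
    finAdelicCongr F E c B ha hB
        (finAdelicBlockDiag F E c N₁ N₂ J₁ J₂ (rationalToFinAdelic F E c N₁ J₁ γ₁, rationalToFinAdelic F E c N₂ J₂ γ₂)) =
      rationalToFinAdelic F E c (N₁ + N₂) H
        ⟨B * ((rationalBlockDiag F E c N₁ N₂ J₁ J₂ (γ₁, γ₂) : rational F E c (N₁ + N₂) (finSum N₁ N₂ J₁ J₂)) : GL (Fin (N₁ + N₂)) E) * B⁻¹,
          (conj_mem_rational_iff F E c B ha hB _).1 (rationalBlockDiag F E c N₁ N₂ J₁ J₂ (γ₁, γ₂)).2⟩ := by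
  rw [finAdelicBlockDiag_rationalToFinAdelic]
  exact finAdelicCongr_rationalToFinAdelic F E c B ha hB _

omit [NumberField F] in
/-- **`B`-adapted principal levels split along the blocks**: for the level `B_f·K_{U(J₁ ⊕ᶠ J₂),f}(𝔫)·B_f⁻¹` of `U(H)(𝔸_{F,f})` (the
principal congruence level of the lattice `B·(𝓞_E^{N₁} ⊕ 𝓞_E^{N₂})`, transported by ★ `finAdelicCongr`), `B_f·(u₁ ⊕ᶠ u₂)·B_f⁻¹` lies in it
iff `u₁ ∈ K_{U(J₁),f}(𝔫)` and `u₂ ∈ K_{U(J₂),f}(𝔫)`.  This is the «one bookkeeping lemma» of the `B`-adapted reading of the levels in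
[Deligne1971TravauxShimura] Prop. 1.15's injectivity argument: with it, `φ(u)·z(ζ) ∈ B_f·K(𝔫)·B_f⁻¹` forces `ζ_f ∈ K_{U(J₂),f}(𝔫)` (and
then `ζ = 1` by the sequel's `eq_one_of_mem_arithmeticLevel_fin_one`).  (For the STANDARD level `K_{U(H),f}(𝔫)` itself the splitting holds only up to a
loss of depth depending on `B`.) [cite: Deligne1971TravauxShimura, Prop. 1.15 (proof, p. 132)] [cite: PlatonovRapinchuk1994, §5.1] -/
theorem finAdelicCongr_finAdelicBlockDiag_mem_map_iff (𝔫 : Ideal (NumberField.RingOfIntegers E))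
    (u : finAdelic F E c N₁ J₁ × finAdelic F E c N₂ J₂) :
    finAdelicCongr F E c B ha hB (finAdelicBlockDiag F E c N₁ N₂ J₁ J₂ u) ∈
        (finCongruenceLevel F E c (N₁ + N₂) (finSum N₁ N₂ J₁ J₂) 𝔫).map (finAdelicCongr F E c B ha hB).toMonoidHom ↔
      u.1 ∈ finCongruenceLevel F E c N₁ J₁ 𝔫 ∧ u.2 ∈ finCongruenceLevel F E c N₂ J₂ 𝔫 := by
  rw [← finAdelicBlockDiag_mem_finCongruenceLevel_iff]
  constructor
  · rintro ⟨k, hk, hku⟩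
    rwa [← (finAdelicCongr F E c B ha hB).injective hku]
  · intro h
    exact ⟨_, h, rfl⟩

end Levels

end Literature.NumberTheory.Automorphic.UnitaryGroup

end
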